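import Mathlib.RingTheory.FormalGroup.Basic
import Mathlib.Algebra.CharP.Basic
import Mathlib.RingTheory.MvPowerSeries.Expand
import Mathlib.RingTheory.MvPowerSeries.Trunc
import Mathlib.RingTheory.MvPowerSeries.Order
import Mathlib.RingTheory.PowerSeries.Substitution
import Mathlib.RingTheory.PowerSeries.Trunc
import HarnessLib

/-!
# Lubin–Tate formal groups: Lubin–Tate's lemma, the formal group law `F_f`, the series `[a]_f`

The formal-group input of the Lubin–Tate construction of the totally ramified abelian extensions
`K_π^n` of a local field (Lubin–Tate, Ann. of Math. 81 (1965), §1; Serre, *Local class field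
theory*, Ch. VI of Cassels–Fröhlich (1967), §3.3–§3.5), over an abstract coefficient ring and
**fully proved**:

* `Literature.LubinTate.IsLTSeries π q f` — `f ∈ 𝔉_π`: `f ≡ πX (mod deg 2)` and `f ≡ X^q (mod π)`
  (Cassels–Fröhlich VI §3.3; e.g. `f = πX + X^q`).
* `Literature.LubinTate.IsLTRing π q` — the hypotheses on `(A, π, q)` under which the theory runs: `π`
  is a non-zero-divisor, the `1 - π^m` (`m ≥ 1`) are units, `q = p^r` with `p` prime and `p ∈ πA`,
  and `a^q ≡ a (mod π)` for all `a ∈ A`.  (For the valuation ring `A = 𝒪_K` of a non-archimedean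
  local field, `π` a uniformizer and `q = #k`: `A` is a domain, local with `π ∈ 𝔪`, `𝒪/π = 𝔽_q`.)
  Cassels–Fröhlich VI §3.5 Remark 2 notes that completeness of `A` is not used.
* `Literature.NumberTheory.GaloisRepresentations.LubinTate.exists_unique` — **Lubin–Tate's lemma** (Lubin–Tate 1965, Lemma 1;
  Cassels–Fröhlich VI §3.5 Prop. 5): for `f, g ∈ 𝔉_π` and a linear form `φ₁ = Σ aᵢ Xᵢ` in finitely
  many variables there is a unique `φ ∈ A⟦X₁, …, Xₙ⟧` with `φ ≡ φ₁ (mod deg 2)` and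
  `f ∘ φ = φ ∘ (g × ⋯ × g)`.
* `Literature.LubinTate.formalGroup hA hf : FormalGroup A` — **the Lubin–Tate formal group law `F_f`**
  (Lubin–Tate 1965 Thm. 1; Cassels–Fröhlich VI §3.5 Prop. 1), a genuine Mathlib `FormalGroup`
  (associativity by uniqueness in three variables), commutative (`formalGroup_isComm`), with
  `f ∈ End(F_f)` (`compLeft_ltF`).
* `Literature.LubinTate.hom hA hf hg a = [a]_{f,g}` (Cassels–Fröhlich VI §3.5 Props. 2–4): the unique
  `[a]_{f,g} ≡ aX (mod deg 2)` with `f ∘ [a] = [a] ∘ g` (`subst_hom`, `eq_hom`); a homomorphism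
  `F_g → F_f` (`ltF_subst_homX`); `[a]_{f,g} ∘ [b]_{g,h} = [ab]_{f,h}` (`hom_comp_hom`),
  `[a + b]_{f,g} = F_f([a], [b])` (`hom_add`), `[π]_f = f` (`hom_self_eq`), `[1]_f = X` (`hom_one`).

This is step P1 of the programme (see `LocalExistenceLubinTate.lean`) towards the norm-group fact
`Literature.NumberTheory.GaloisRepresentations.exists_abelian_norm_le_lubinTate` (`N(K_π^nˣ) ⊆ ⟨π⟩ · U^{(n)}`), whose remaining steps are the
`π^n`-division points `K_π^n = K(F_f[π^n])` and Coleman's norm operator.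

## The proof of Lubin–Tate's lemma (Cassels–Fröhlich VI §3.5, PDF pp. 192–193 of the held copy)

Write `D φ = f ∘ φ - φ ∘ (g,…,g)` (`defect`).  The key congruence (`le_order_defect_sub`): if
`φ' ≡ φ (mod deg m+1)` (no constant terms) then `D φ' - D φ ≡ (π - π^{m+1})(φ' - φ) (mod deg m+2)`
— because `f ∘ φ' - f ∘ φ ≡ f₁ (φ' - φ)` (`le_order_compLeft_sub`: `φ'^k - φ^k` has order
`≥ m + k`) and `ψ ∘ (g,…,g) ≡ π^{m+1} ψ` for `ord ψ ≥ m+1` (`le_order_compRight_sub`: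
`∏ g(X_i)^{d_i} ≡ π^{|d|} X^d (mod deg |d|+1)`).  Reducing modulo `π`, `f̄ = ḡ = X^q` and
`φ̄^q = φ̄(X^q)` over `A/π` (`pow_eq_expand_of_isLTRing`: Mathlib's `map_iterateFrobenius_expand`
and `a^q = a`), so every coefficient of `D φ` is divisible by `π` (`dvd_coeff_defect`).  Hence an
approximant with `ord D φ ≥ m + 2` (`Approx`) can be corrected by the homogeneous
`δ = -(D φ)_{m+2} / (π (1 - π^{m+1}))` of degree `m + 2` (`Approx.corr`, `Approx.next`); the
coefficientwise limit of the approximants (`limit`) solves `D φ = 0` (`defect_limit`), and the same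
congruence with `π(1 - π^m)` a non-zero-divisor gives uniqueness (`eq_of_defect_eq_zero`).  The
formal group law, its commutativity and all identities between the `[a]_{f,g}` are instances of
uniqueness, via the composition lemma `compLeft_subst_eq_compRight` ("`F ∘ (b₁,…,bₙ)` is
equivariant when `F` and the `bⱼ` are").

## Design notes

* Everything is phrased with Mathlib's `MvPowerSeries.subst` / `PowerSeries.subst`
  (`f ∘ φ = PowerSeries.subst φ f`, `φ ∘ (g,…,g) = MvPowerSeries.subst (fun i ↦ g(X_i)) φ`) over an
  arbitrary finite set of variables `σ`; `[a]_{f,g}` is the case `σ = Unit` (`PowerSeries A` is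
  `MvPowerSeries Unit A` by definition) and `F_f` the case `σ = Fin 2`, so that `formalGroup` is
  literally a Mathlib `FormalGroup A` (`Mathlib.RingTheory.FormalGroup.Basic`).
* No topology on `A⟦X⟧` is used: congruences `mod deg n` are inequalities on
  `MvPowerSeries.order`, and the limit is defined coefficientwise from the stabilising sequence of
  approximants (`coeff_approxSeq_of_le`).
* `IsLTRing` isolates exactly what the printed proof uses; it is a `Prop`-valued structure, not a
  class.  The instance "valuation ring of a local field" is left to the sequel (torsion points).

## References

* J. Lubin, J. Tate, *Formal complex multiplication in local fields*, Ann. of Math. 81 (1965),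
  380–387: §1, Lemma 1 (p. 381), the definitions (4)–(5) and Theorem 1 with its identities (6)–(11)
  (p. 382) — read in the held copy.  [LubinTate1965]
* J.-P. Serre, *Local class field theory*, Ch. VI in: J. W. S. Cassels, A. Fröhlich (eds.),
  *Algebraic Number Theory*, Academic Press 1967: §3.2 (formal group laws), §3.3 (`𝔉_π`), §3.4
  Props. 1–4 (statements), §3.5 Prop. 5 and the proofs of Props. 1–4 (PDF pp. 190–194 of the held
  copy).  [CasselsFrohlichANT1967]
* E. de Shalit, *Iwasawa theory of elliptic curves with complex multiplication* (1987), Ch. I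
  §1.3–1.5 (the relative version).  [deShalit1987]

## Mathlib reuse

`FormalGroup` (`Mathlib.RingTheory.FormalGroup.Basic`, 2026), `MvPowerSeries.subst`,
`PowerSeries.subst`, `MvPowerSeries.subst_comp_subst_apply`, `MvPowerSeries.coeff_subst`,
`PowerSeries.coeff_subst`, `PowerSeries.coeff_subst_single`, `MvPowerSeries.map_subst`,
`MvPowerSeries.expand`, `MvPowerSeries.map_iterateFrobenius_expand`, `MvPowerSeries.order` and its
API (`le_order_mul`, `le_order_prod`, `le_order_pow_of_constantCoeff_eq_zero`, `nat_le_order`,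
`coeff_of_lt_order`), `MvPowerSeries.truncTotal`, `CharP.charP_iff_prime_eq_zero`, `geom_sum₂_mul`.
`lean search 'LubinTate|lubinTate'` finds nothing in Mathlib at this pin.
-/
noncomputable section

open MvPowerSeries

namespace Literature.NumberTheory.GaloisRepresentations

namespace LubinTate

variable {A : Type*} [CommRing A] {σ : Type*}

/-! ### Order bookkeeping -/

/-- If `ord uᵢ, ord vᵢ ≥ 1` and `ord (uᵢ - vᵢ) ≥ 2` then `ord (∏ uᵢ - ∏ vᵢ) ≥ N + 1` for `N`
factors. [folklore] -/
theorem le_order_prod_sub_prod {ι : Type*} (s : Finset ι) (u v : ι → MvPowerSeries σ A)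
    (hu : ∀ i ∈ s, 1 ≤ (u i).order) (hv : ∀ i ∈ s, 1 ≤ (v i).order)
    (huv : ∀ i ∈ s, 2 ≤ (u i - v i).order) :
    (s.card + 1 : ℕ) ≤ (∏ i ∈ s, u i - ∏ i ∈ s, v i).order := by
  classical
  induction s using Finset.induction_on with
  | empty => simp
  | insert a s ha ih =>
    rw [Finset.prod_insert ha, Finset.prod_insert ha, Finset.card_insert_of_notMem ha]
    have hu' : ∀ i ∈ s, 1 ≤ (u i).order := fun i hi => hu i (Finset.mem_insert_of_mem hi)
    have hv' : ∀ i ∈ s, 1 ≤ (v i).order := fun i hi => hv i (Finset.mem_insert_of_mem hi)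
    have huv' : ∀ i ∈ s, 2 ≤ (u i - v i).order := fun i hi => huv i (Finset.mem_insert_of_mem hi)
    have ih' := ih hu' hv' huv'
    have h1 : u a * ∏ i ∈ s, u i - v a * ∏ i ∈ s, v i =
        u a * (∏ i ∈ s, u i - ∏ i ∈ s, v i) + (u a - v a) * ∏ i ∈ s, v i := by ring
    rw [h1]
    refine le_trans ?_ (min_order_le_add)
    refine le_min ?_ ?_
    · refine le_trans ?_ (le_order_mul)
      have := add_le_add (hu a (Finset.mem_insert_self a s)) ih'
      refine le_trans ?_ this
      push_cast
      rw [add_comm]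
    · refine le_trans ?_ (le_order_mul)
      have hQ : (s.card : ℕ∞) ≤ (∏ i ∈ s, v i).order := by
        refine le_trans ?_ (le_order_prod _ _)
        rw [show (s.card : ℕ∞) = ∑ i ∈ s, (1 : ℕ∞) by simp]
        exact Finset.sum_le_sum hv'
      have := add_le_add (huv a (Finset.mem_insert_self a s)) hQ
      refine le_trans ?_ this
      push_cast
      rw [add_comm (2 : ℕ∞), add_assoc]
      rfl

/-- Order of a finite sum. [folklore] -/
theorem le_order_sum {ι : Type*} (s : Finset ι) (f : ι → MvPowerSeries σ A) {n : ℕ∞}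
    (h : ∀ i ∈ s, n ≤ (f i).order) : n ≤ (∑ i ∈ s, f i).order := by
  classical
  induction s using Finset.induction_on with
  | empty => simp
  | insert a s ha ih =>
    rw [Finset.sum_insert ha]
    exact le_trans (le_min (h a (Finset.mem_insert_self a s))
      (ih fun i hi => h i (Finset.mem_insert_of_mem hi))) min_order_le_add

/-- `ord (u^k - v^k) ≥ m + k` if `ord u, ord v ≥ 1` and `ord (u - v) ≥ m + 1`. [folklore] -/
theorem le_order_pow_sub_pow (u v : MvPowerSeries σ A) (hu : u.constantCoeff = 0)
    (hv : v.constantCoeff = 0) {m : ℕ} (huv : ((m + 1 : ℕ) : ℕ∞) ≤ (u - v).order) (k : ℕ)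
    (hk : 1 ≤ k) : ((m + k : ℕ) : ℕ∞) ≤ (u ^ k - v ^ k).order := by
  rw [← geom_sum₂_mul]
  refine le_trans ?_ le_order_mul
  have h1 : ((k - 1 : ℕ) : ℕ∞) ≤ (∑ i ∈ Finset.range k, u ^ i * v ^ (k - 1 - i)).order := by
    refine le_order_sum _ _ fun i hi => ?_
    refine le_trans ?_ le_order_mul
    have hi' : i < k := Finset.mem_range.mp hi
    calc ((k - 1 : ℕ) : ℕ∞) = (i : ℕ∞) + ((k - 1 - i : ℕ) : ℕ∞) := by
          rw [← Nat.cast_add]; congr 1; omega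
      _ ≤ (u ^ i).order + (v ^ (k - 1 - i)).order :=
          add_le_add (le_order_pow_of_constantCoeff_eq_zero _ hu)
            (le_order_pow_of_constantCoeff_eq_zero _ hv)
  calc ((m + k : ℕ) : ℕ∞) = ((k - 1 : ℕ) : ℕ∞) + ((m + 1 : ℕ) : ℕ∞) := by
        rw [← Nat.cast_add]; congr 1; omega
    _ ≤ _ := add_le_add h1 huv

/-- Products with exponents: `ord (∏ u_i^{d_i} - ∏ v_i^{d_i}) ≥ (Σ d_i) + 1` when
`ord u_i, ord v_i ≥ 1` and `ord (u_i - v_i) ≥ 2`. [folklore] -/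
theorem le_order_prod_pow_sub_prod_pow {ι : Type*} (s : Finset ι) (d : ι → ℕ)
    (u v : ι → MvPowerSeries σ A) (hu : ∀ i ∈ s, (u i).constantCoeff = 0)
    (hv : ∀ i ∈ s, (v i).constantCoeff = 0) (huv : ∀ i ∈ s, (2 : ℕ∞) ≤ (u i - v i).order) :
    ((∑ i ∈ s, d i) + 1 : ℕ) ≤ (∏ i ∈ s, u i ^ d i - ∏ i ∈ s, v i ^ d i).order := by
  classical
  induction s using Finset.induction_on with
  | empty => simp
  | insert a s ha ih =>
    rw [Finset.prod_insert ha, Finset.prod_insert ha, Finset.sum_insert ha]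
    have hu' : ∀ i ∈ s, (u i).constantCoeff = 0 := fun i hi => hu i (Finset.mem_insert_of_mem hi)
    have hv' : ∀ i ∈ s, (v i).constantCoeff = 0 := fun i hi => hv i (Finset.mem_insert_of_mem hi)
    have huv' : ∀ i ∈ s, (2 : ℕ∞) ≤ (u i - v i).order := fun i hi =>
      huv i (Finset.mem_insert_of_mem hi)
    have ih' := ih hu' hv' huv'
    set N := ∑ i ∈ s, d i with hN
    have h1 : u a ^ d a * ∏ i ∈ s, u i ^ d i - v a ^ d a * ∏ i ∈ s, v i ^ d i =
        u a ^ d a * (∏ i ∈ s, u i ^ d i - ∏ i ∈ s, v i ^ d i) +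
          (u a ^ d a - v a ^ d a) * ∏ i ∈ s, v i ^ d i := by ring
    rw [h1]
    refine le_trans (le_min ?_ ?_) min_order_le_add
    · refine le_trans ?_ le_order_mul
      calc ((d a + N + 1 : ℕ) : ℕ∞) = (d a : ℕ∞) + ((N + 1 : ℕ) : ℕ∞) := by push_cast; ring
        _ ≤ _ := add_le_add (le_order_pow_of_constantCoeff_eq_zero _
            (hu a (Finset.mem_insert_self a s))) ih'
    · have hQ : (N : ℕ∞) ≤ (∏ i ∈ s, v i ^ d i).order := by
        refine le_trans ?_ (le_order_prod _ _)
        rw [hN, Nat.cast_sum]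
        exact Finset.sum_le_sum fun i hi => le_order_pow_of_constantCoeff_eq_zero _ (hv' i hi)
      have hua := hu a (Finset.mem_insert_self a s)
      have hva := hv a (Finset.mem_insert_self a s)
      have h2 : (2 : ℕ∞) ≤ (u a - v a).order := huv a (Finset.mem_insert_self a s)
      rcases Nat.eq_zero_or_pos (d a) with h0 | hpos
      · -- `d a = 0`: the factor `u^0 - v^0 = 0`
        rw [h0, pow_zero, pow_zero, sub_self, zero_mul, order_zero]
        exact le_top
      · refine le_trans ?_ le_order_mul
        have hP : ((1 + d a : ℕ) : ℕ∞) ≤ (u a ^ d a - v a ^ d a).order :=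
          le_order_pow_sub_pow (u a) (v a) hua hva (m := 1) (by exact_mod_cast h2) (d a) hpos
        calc ((d a + N + 1 : ℕ) : ℕ∞) = ((1 + d a : ℕ) : ℕ∞) + (N : ℕ∞) := by push_cast; ring
          _ ≤ _ := add_le_add hP hQ

/-- `truncTotal n φ = 0 ↔ n ≤ ord φ`. [folklore] -/
theorem truncTotal_eq_zero_iff [Finite σ] {n : ℕ} {φ : MvPowerSeries σ A} :
    truncTotal n φ = 0 ↔ (n : ℕ∞) ≤ φ.order := by
  constructor
  · intro h
    refine nat_le_order fun d hd => ?_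
    have := congrArg (MvPolynomial.coeff d) h
    rwa [coeff_truncTotal _ hd, MvPolynomial.coeff_zero] at this
  · intro h
    ext d
    rw [MvPolynomial.coeff_zero, coeff_truncTotal_eq_ite]
    split_ifs with hd
    · exact coeff_of_lt_order (lt_of_lt_of_le (by exact_mod_cast hd) h)
    · rfl

/-! ### Lubin–Tate series and the defect `f ∘ φ - φ ∘ (g, …, g)` -/

variable (π : A) (q : ℕ)

/-- `f ∈ 𝔉_π`: `f ≡ π X (mod deg 2)` and `f ≡ X^q (mod π)`.
[cite: CasselsFrohlichANT1967, Ch. VI §3.3] -/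
structure IsLTSeries (f : PowerSeries A) : Prop where
  constantCoeff_eq_zero : PowerSeries.constantCoeff f = 0
  coeff_one : PowerSeries.coeff 1 f = π
  dvd_coeff_sub : ∀ n, π ∣ PowerSeries.coeff n f - (if n = q then 1 else 0)

variable {π q}

/-- **Non-vacuity / the canonical example**: `f = πX + X^q ∈ 𝔉_π` for any commutative ring `A` and
`q ≥ 2` (Cassels–Fröhlich VI §3.3, Example (a); Lubin–Tate 1965, p. 380: "the simplest choice for an
element `f ∈ 𝔉_π` is `f(T) = πT + T^q`"). [cite: CasselsFrohlichANT1967, Ch. VI §3.3 Example (a)] -/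
theorem isLTSeries_C_mul_X_add_X_pow (hq : 2 ≤ q) :
    IsLTSeries π q (PowerSeries.C π * PowerSeries.X + PowerSeries.X ^ q) := by
  have hcoeff : ∀ n, PowerSeries.coeff n (PowerSeries.C π * PowerSeries.X + PowerSeries.X ^ q) =
      (if n = 1 then π else 0) + (if n = q then 1 else 0) := fun n => by
    rw [map_add, PowerSeries.coeff_C_mul, PowerSeries.coeff_X, PowerSeries.coeff_X_pow, mul_ite,
      mul_one, mul_zero]
  refine ⟨?_, ?_, fun n => ?_⟩
  · rw [← PowerSeries.coeff_zero_eq_constantCoeff_apply, hcoeff, if_neg zero_ne_one,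
      if_neg (by omega), add_zero]
  · rw [hcoeff, if_pos rfl, if_neg (by omega), add_zero]
  · rw [hcoeff, add_sub_cancel_right]
    split_ifs
    · exact dvd_rfl
    · exact dvd_zero _

section Defect

variable [Fintype σ]

/-- `φ ∘ (g, …, g)`: substitute `g(X_i)` for `X_i`. [folklore] -/
def compRight (g : PowerSeries A) (φ : MvPowerSeries σ A) : MvPowerSeries σ A :=
  MvPowerSeries.subst (fun i : σ => PowerSeries.subst (MvPowerSeries.X i : MvPowerSeries σ A) g) φ

/-- `f ∘ φ`. [folklore] -/
def compLeft (f : PowerSeries A) (φ : MvPowerSeries σ A) : MvPowerSeries σ A :=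
  PowerSeries.subst φ f

/-- The defect `f ∘ φ - φ ∘ (g, …, g)`. [folklore] -/
def defect (f g : PowerSeries A) (φ : MvPowerSeries σ A) : MvPowerSeries σ A :=
  compLeft f φ - compRight g φ

omit [Fintype σ] in
/-- A series without constant term may be substituted. [folklore] -/
theorem hasSubst_of_constantCoeff {φ : MvPowerSeries σ A} (hφ : φ.constantCoeff = 0) :
    PowerSeries.HasSubst φ :=
  PowerSeries.HasSubst.of_constantCoeff_zero hφ

omit [Fintype σ] in
/-- `g(X_i)` has no constant term. [folklore] -/
theorem constantCoeff_subst_X {g : PowerSeries A} (hg : PowerSeries.constantCoeff g = 0) (i : σ) :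
    (PowerSeries.subst (MvPowerSeries.X i : MvPowerSeries σ A) g).constantCoeff = 0 := by
  rw [PowerSeries.subst, MvPowerSeries.constantCoeff_subst_eq_zero]
  · exact MvPowerSeries.hasSubst_of_constantCoeff_zero (fun _ => MvPowerSeries.constantCoeff_X i)
  · intro _; exact MvPowerSeries.constantCoeff_X i
  · exact hg

/-- The family `(g(X_i))_i` may be substituted. [folklore] -/
theorem hasSubst_compRight {g : PowerSeries A} (hg : PowerSeries.constantCoeff g = 0) :
    MvPowerSeries.HasSubst
      (fun i : σ => PowerSeries.subst (MvPowerSeries.X i : MvPowerSeries σ A) g) :=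
  MvPowerSeries.hasSubst_of_constantCoeff_zero (fun i => constantCoeff_subst_X hg i)

omit [Fintype σ] in
/-- `g(X_i) - π X_i` has order `≥ 2` when `g ≡ π X (mod deg 2)`. [folklore] -/
theorem two_le_order_subst_X_sub {g : PowerSeries A} (hg0 : PowerSeries.constantCoeff g = 0)
    (hg1 : PowerSeries.coeff 1 g = π) (i : σ) :
    (2 : ℕ∞) ≤ (PowerSeries.subst (MvPowerSeries.X i : MvPowerSeries σ A) g -
      MvPowerSeries.C π * MvPowerSeries.X i).order := by
  classical
  refine nat_le_order fun d hd => ?_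
  rw [map_sub, PowerSeries.coeff_subst_single, MvPowerSeries.coeff_C_mul, MvPowerSeries.coeff_X]
  have hd2 : d.degree < 2 := by exact_mod_cast hd
  split_ifs with h1 h2 h2
  · -- `d = single i (d i)` and `d = single i 1`
    have : d i = 1 := by rw [h2]; simp
    rw [this, hg1, mul_one, sub_self]
  · -- `d = single i (d i)`, `d ≠ single i 1`: then `d i = 0` (degree < 2), coefficient `g_0 = 0`
    have hdi : d i < 2 := by
      have : d.degree = d i := by rw [h1]; simp
      omega
    interval_cases hdi' : d i
    · rw [PowerSeries.coeff_zero_eq_constantCoeff_apply, hg0, mul_zero, sub_zero]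
    · exact absurd h1 h2
  · exact absurd (h2.trans (by rw [h2]; simp)) h1
  · simp

omit [Fintype σ] in
/-- `∏_{i} (π X_i)^{d_i} = π^{|d|} X^d`. [folklore] -/
theorem prod_C_mul_X_pow (d : σ →₀ ℕ) :
    (d.prod fun i n => (MvPowerSeries.C π * MvPowerSeries.X i : MvPowerSeries σ A) ^ n) =
      MvPowerSeries.C (π ^ d.degree) * MvPowerSeries.monomial d 1 := by
  rw [MvPowerSeries.monomial_eq', map_one, one_mul, Finsupp.prod, Finsupp.prod]
  simp_rw [mul_pow, Finset.prod_mul_distrib, ← map_pow, ← map_prod]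
  congr 2
  rw [Finset.prod_pow_eq_pow_sum, Finsupp.degree_apply]

omit [Fintype σ] in
/-- `ord (∏ g(X_i)^{d_i} - π^{|d|} X^d) ≥ |d| + 1` for `g ≡ πX (mod deg 2)`. [folklore] -/
theorem le_order_prod_subst_sub {g : PowerSeries A} (hg0 : PowerSeries.constantCoeff g = 0)
    (hg1 : PowerSeries.coeff 1 g = π) (d : σ →₀ ℕ) :
    ((d.degree + 1 : ℕ) : ℕ∞) ≤ ((d.prod fun i n =>
        (PowerSeries.subst (MvPowerSeries.X i : MvPowerSeries σ A) g) ^ n) -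
      MvPowerSeries.C (π ^ d.degree) * MvPowerSeries.monomial d 1).order := by
  rw [← prod_C_mul_X_pow, Finsupp.prod, Finsupp.prod, Finsupp.degree_apply]
  refine le_order_prod_pow_sub_prod_pow d.support d _ _ (fun i _ => constantCoeff_subst_X hg0 i)
    (fun i _ => by simp) (fun i _ => two_le_order_subst_X_sub hg0 hg1 i)

omit [Fintype σ] in
/-- `ord (∏ g(X_i)^{d_i}) ≥ |d|`. [folklore] -/
theorem degree_le_order_prod_subst {g : PowerSeries A} (hg0 : PowerSeries.constantCoeff g = 0)
    (d : σ →₀ ℕ) :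
    (d.degree : ℕ∞) ≤ (d.prod fun i n =>
        (PowerSeries.subst (MvPowerSeries.X i : MvPowerSeries σ A) g) ^ n).order := by
  rw [Finsupp.prod, Finsupp.degree_apply, Nat.cast_sum]
  refine le_trans (Finset.sum_le_sum fun i _ => ?_) (le_order_prod _ _)
  exact le_order_pow_of_constantCoeff_eq_zero _ (constantCoeff_subst_X hg0 i)

omit [Fintype σ] in
/-- **The substitution `f ∘ ·` to first order**: if `φ' ≡ φ (mod deg m+1)` (both without
constant term) then `f ∘ φ' - f ∘ φ ≡ f₁ · (φ' - φ) (mod deg m+2)`.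
[cite: CasselsFrohlichANT1967, Ch. VI §3.5 Prop. 5 (proof)] -/
theorem le_order_compLeft_sub (f : PowerSeries A) {φ φ' : MvPowerSeries σ A}
    (hφ : φ.constantCoeff = 0) (hφ' : φ'.constantCoeff = 0) {m : ℕ}
    (h : ((m + 1 : ℕ) : ℕ∞) ≤ (φ' - φ).order) :
    ((m + 2 : ℕ) : ℕ∞) ≤ (compLeft f φ' - compLeft f φ -
      MvPowerSeries.C (PowerSeries.coeff 1 f) * (φ' - φ)).order := by
  have hs := hasSubst_of_constantCoeff hφ
  have hs' := hasSubst_of_constantCoeff hφ'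
  refine nat_le_order fun e he => ?_
  rw [map_sub, map_sub, compLeft, compLeft, PowerSeries.coeff_subst hs',
    PowerSeries.coeff_subst hs, MvPowerSeries.coeff_C_mul,
    ← finsum_sub_distrib (PowerSeries.coeff_subst_finite hs' f e)
      (PowerSeries.coeff_subst_finite hs f e), finsum_eq_single _ 1]
  · simp only [pow_one, smul_eq_mul, map_sub]
    ring
  · intro d hd1
    rw [← smul_sub, ← map_sub]
    rcases Nat.lt_or_ge d 1 with h0 | h2
    · have : d = 0 := by omega
      rw [this, pow_zero, pow_zero, sub_self, map_zero, smul_zero]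
    · have h2' : 2 ≤ d := by omega
      have hord : ((m + d : ℕ) : ℕ∞) ≤ (φ' ^ d - φ ^ d).order :=
        le_order_pow_sub_pow φ' φ hφ' hφ h d (by omega)
      rw [coeff_of_lt_order (lt_of_lt_of_le (by exact_mod_cast (by omega : e.degree < m + d)) hord),
        smul_zero]

/-- **The substitution `· ∘ (g,…,g)` to first order**: if `ord ψ ≥ m + 1` then
`ψ ∘ (g,…,g) ≡ π^{m+1} ψ (mod deg m+2)` for `g ≡ πX (mod deg 2)`.
[cite: CasselsFrohlichANT1967, Ch. VI §3.5 Prop. 5 (proof)] -/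
theorem le_order_compRight_sub {g : PowerSeries A} (hg0 : PowerSeries.constantCoeff g = 0)
    (hg1 : PowerSeries.coeff 1 g = π) {ψ : MvPowerSeries σ A} {m : ℕ}
    (h : ((m + 1 : ℕ) : ℕ∞) ≤ ψ.order) :
    ((m + 2 : ℕ) : ℕ∞) ≤ (compRight g ψ - MvPowerSeries.C (π ^ (m + 1)) * ψ).order := by
  classical
  refine nat_le_order fun e he => ?_
  have he' : e.degree < m + 2 := by exact_mod_cast he
  rw [map_sub, compRight, MvPowerSeries.coeff_subst (hasSubst_compRight hg0),
    MvPowerSeries.coeff_C_mul, finsum_eq_single _ e]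
  · -- the term `d = e`
    rcases Nat.lt_or_ge e.degree (m + 1) with hlt | hge
    · -- `deg e ≤ m`: `coeff e ψ = 0`
      rw [coeff_of_lt_order (lt_of_lt_of_le (by exact_mod_cast hlt) h), zero_smul, mul_zero,
        sub_self]
    · have hdeg : e.degree = m + 1 := by omega
      have hord := le_order_prod_subst_sub (σ := σ) hg0 hg1 e
      have hce : MvPowerSeries.coeff e (e.prod fun i n =>
          (PowerSeries.subst (MvPowerSeries.X i : MvPowerSeries σ A) g) ^ n) = π ^ (m + 1) := by
        have h0 := coeff_of_lt_order (lt_of_lt_of_le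
          (by rw [hdeg]; exact_mod_cast Nat.lt_succ_self _) hord)
        rw [map_sub, sub_eq_zero, MvPowerSeries.coeff_C_mul, MvPowerSeries.coeff_monomial_same,
          mul_one, hdeg] at h0
        exact h0
      rw [hce, smul_eq_mul, mul_comm, sub_self]
  · intro d hde
    by_cases hψ : MvPowerSeries.coeff d ψ = 0
    · rw [hψ, zero_smul]
    -- `coeff d ψ ≠ 0` forces `deg d ≥ m + 1`
    have hd : m + 1 ≤ d.degree := by
      by_contra hlt
      push Not at hlt
      exact hψ (coeff_of_lt_order (lt_of_lt_of_le (by exact_mod_cast hlt) h))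
    rcases Nat.lt_or_ge e.degree d.degree with hlt | hge
    · -- order of the product is `≥ deg d > deg e`
      rw [coeff_of_lt_order (lt_of_lt_of_le (by exact_mod_cast hlt)
        (degree_le_order_prod_subst hg0 d)), smul_zero]
    · -- `deg d = deg e = m + 1`, `d ≠ e`: coefficient of `π^{m+1} X^d` at `e` vanishes
      have hdeg : d.degree = e.degree := by omega
      have hord := le_order_prod_subst_sub (σ := σ) hg0 hg1 d
      have h0 := coeff_of_lt_order (d := e) (lt_of_lt_of_le
          (by rw [hdeg]; exact_mod_cast Nat.lt_succ_self _) hord)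
      rw [map_sub, sub_eq_zero, MvPowerSeries.coeff_C_mul, MvPowerSeries.coeff_monomial,
        if_neg (Ne.symm hde), mul_zero] at h0
      rw [h0, smul_zero]

/-- **Key congruence.**  For `f ≡ πX ≡ g (mod deg 2)` and `φ' ≡ φ (mod deg m+1)` (no constant
terms): `D φ' - D φ ≡ (π - π^{m+1}) (φ' - φ) (mod deg m+2)`, where `D = defect f g`.
[cite: CasselsFrohlichANT1967, Ch. VI §3.5 Prop. 5 (proof)] -/
theorem le_order_defect_sub {f g : PowerSeries A} (hf1 : PowerSeries.coeff 1 f = π)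
    (hg0 : PowerSeries.constantCoeff g = 0) (hg1 : PowerSeries.coeff 1 g = π)
    {φ φ' : MvPowerSeries σ A} (hφ : φ.constantCoeff = 0) (hφ' : φ'.constantCoeff = 0) {m : ℕ}
    (h : ((m + 1 : ℕ) : ℕ∞) ≤ (φ' - φ).order) :
    ((m + 2 : ℕ) : ℕ∞) ≤ (defect f g φ' - defect f g φ -
      MvPowerSeries.C (π - π ^ (m + 1)) * (φ' - φ)).order := by
  have h1 := le_order_compLeft_sub f hφ hφ' h
  have h2 := le_order_compRight_sub (σ := σ) hg0 hg1 (ψ := φ' - φ) h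
  rw [hf1] at h1
  have hlin : compRight g (φ' - φ) = compRight g φ' - compRight g φ := by
    rw [compRight, compRight, compRight, MvPowerSeries.subst_sub (hasSubst_compRight hg0)]
  have : defect f g φ' - defect f g φ - MvPowerSeries.C (π - π ^ (m + 1)) * (φ' - φ) =
      (compLeft f φ' - compLeft f φ - MvPowerSeries.C π * (φ' - φ)) -
        (compRight g (φ' - φ) - MvPowerSeries.C (π ^ (m + 1)) * (φ' - φ)) := by
    rw [hlin, defect, defect, map_sub]
    ring
  rw [this, sub_eq_add_neg]
  refine le_trans (le_min h1 ?_) min_order_le_add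
  rwa [order_neg]

/-- The linear approximation `φ₁ = Σ aᵢ Xᵢ`. [folklore] -/
def linearPart (a : σ → A) : MvPowerSeries σ A := ∑ i, MvPowerSeries.C (a i) * MvPowerSeries.X i

/-- `φ₁` has no constant term. [folklore] -/
theorem constantCoeff_linearPart (a : σ → A) : (linearPart a).constantCoeff = 0 := by
  simp [linearPart]

/-- The linear coefficients of `φ₁ = Σ aᵢ Xᵢ` are the `aᵢ`. [folklore] -/
theorem coeff_linearPart_single (a : σ → A) (i : σ) :
    MvPowerSeries.coeff (Finsupp.single i 1) (linearPart a) = a i := by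
  classical
  rw [linearPart, map_sum, Finset.sum_eq_single i]
  · rw [MvPowerSeries.coeff_C_mul, MvPowerSeries.coeff_X, if_pos rfl, mul_one]
  · intro j _ hji
    rw [MvPowerSeries.coeff_C_mul, MvPowerSeries.coeff_X, if_neg, mul_zero]
    intro h
    exact hji (Finsupp.single_left_injective one_ne_zero h).symm
  · intro h; exact absurd (Finset.mem_univ i) h

/-- `defect f g 0 = 0` (for `f` without constant term). [folklore] -/
theorem defect_zero {f g : PowerSeries A} (hf0 : PowerSeries.constantCoeff f = 0)
    (hg0 : PowerSeries.constantCoeff g = 0) : defect f g (0 : MvPowerSeries σ A) = 0 := by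
  rw [defect, compLeft, compRight, PowerSeries.subst_zero_of_constantCoeff_zero hf0,
    ← MvPowerSeries.coe_substAlgHom (hasSubst_compRight hg0), map_zero, sub_zero]

/-- Stage one: `ord D(φ₁) ≥ 2`. [folklore] -/
theorem two_le_order_defect_linearPart {f g : PowerSeries A}
    (hf0 : PowerSeries.constantCoeff f = 0) (hf1 : PowerSeries.coeff 1 f = π)
    (hg0 : PowerSeries.constantCoeff g = 0) (hg1 : PowerSeries.coeff 1 g = π) (a : σ → A) :
    (2 : ℕ∞) ≤ (defect f g (linearPart a)).order := by
  have h := le_order_defect_sub (σ := σ) hf1 hg0 hg1 (φ := 0) (φ' := linearPart a) (m := 0)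
    (by simp) (constantCoeff_linearPart a)
    (by rw [sub_zero]; exact_mod_cast
      (one_le_order_iff_constCoeff_eq_zero.mpr (constantCoeff_linearPart a)))
  simpa [defect_zero hf0 hg0] using h

end Defect

/-! ### The base ring: `π` regular, `1 - π^m` units, `A/π` of characteristic `p`, `a^q ≡ a` -/

variable (π q) in
/-- Hypotheses on `(A, π, q)` under which Lubin–Tate's lemma holds: `π` is a non-zero-divisor,
the `1 - π^m` (`m ≥ 1`) are units (e.g. `A` local and `π` in the maximal ideal), `q = p^r` with
`p` prime and `p ∈ πA`, and `a^q ≡ a (mod π)` for all `a` (e.g. `A/πA = 𝔽_q`).  Satisfied by the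
valuation ring of a non-archimedean local field with uniformizer `π` and `q` the residue
cardinality. [cite: CasselsFrohlichANT1967, Ch. VI §3.5 Prop. 5, Remark 2] -/
structure IsLTRing : Prop where
  eq_zero_of_mul_eq_zero : ∀ x : A, π * x = 0 → x = 0
  isUnit_one_sub_pow : ∀ m : ℕ, 0 < m → IsUnit (1 - π ^ m)
  exists_prime : ∃ p r : ℕ, p.Prime ∧ q = p ^ r ∧ (p : A) ∈ Ideal.span {π}
  dvd_pow_sub : ∀ a : A, π ∣ a ^ q - a

section Frobenius

variable [Fintype σ]

/-- An LT series reduces to `X^q` modulo `π`. [cite: CasselsFrohlichANT1967, Ch. VI §3.3] -/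
theorem IsLTSeries.map_mk {f : PowerSeries A} (hf : IsLTSeries π q f) :
    f.map (Ideal.Quotient.mk (Ideal.span {π})) = PowerSeries.X ^ q := by
  ext n
  rw [PowerSeries.coeff_map, PowerSeries.coeff_X_pow]
  have h := hf.dvd_coeff_sub n
  rw [← Ideal.mem_span_singleton, ← Ideal.Quotient.eq_zero_iff_mem, map_sub, sub_eq_zero] at h
  rw [h]
  split_ifs <;> simp

omit [Fintype σ] in
/-- **Frobenius**: over `A/π`, `φ^q = φ(X₁^q, …, Xₙ^q)` (all coefficients satisfy `a^q = a`,
and `q` is a power of the characteristic).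
[cite: CasselsFrohlichANT1967, Ch. VI §3.5 Prop. 5 (proof)] -/
theorem pow_eq_expand_of_isLTRing (hA : IsLTRing π q) (hq : q ≠ 0)
    (φ : MvPowerSeries σ (A ⧸ Ideal.span {π})) :
    φ ^ q = MvPowerSeries.expand q hq φ := by
  rcases subsingleton_or_nontrivial (A ⧸ Ideal.span {π}) with hR | hR
  · ext e; exact Subsingleton.elim _ _
  obtain ⟨p, r, hp, hqpr, hpmem⟩ := hA.exists_prime
  haveI : Fact p.Prime := ⟨hp⟩
  have hp0 : (p : A ⧸ Ideal.span {π}) = 0 := by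
    rw [show (p : A ⧸ Ideal.span {π}) = Ideal.Quotient.mk (Ideal.span {π}) (p : A) by simp,
      Ideal.Quotient.eq_zero_iff_mem]
    exact hpmem
  haveI : CharP (A ⧸ Ideal.span {π}) p := (CharP.charP_iff_prime_eq_zero hp).mpr hp0
  have hfix : φ.map (iterateFrobenius (A ⧸ Ideal.span {π}) p r) = φ := by
    ext e
    rw [MvPowerSeries.coeff_map, iterateFrobenius_def, ← hqpr]
    obtain ⟨a, ha⟩ := Ideal.Quotient.mk_surjective (MvPowerSeries.coeff e φ)
    rw [← ha, ← map_pow, eq_comm, ← sub_eq_zero, ← map_sub, Ideal.Quotient.eq_zero_iff_mem,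
      Ideal.mem_span_singleton, ← dvd_neg, neg_sub]
    exact hA.dvd_pow_sub a
  subst hqpr
  rw [← MvPowerSeries.map_iterateFrobenius_expand p hp.ne_zero φ r, MvPowerSeries.map_expand, hfix]

/-- **The defect is divisible by `π`**: for LT series `f, g` and `φ` without constant term,
every coefficient of `f ∘ φ - φ ∘ (g,…,g)` is divisible by `π` (reduce mod `π`:
`φ̄^q - φ̄(X^q) = 0`). [cite: CasselsFrohlichANT1967, Ch. VI §3.5 Prop. 5 (proof)] -/
theorem dvd_coeff_defect (hA : IsLTRing π q) {f g : PowerSeries A} (hf : IsLTSeries π q f)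
    (hg : IsLTSeries π q g) {φ : MvPowerSeries σ A} (hφ : φ.constantCoeff = 0) (e : σ →₀ ℕ) :
    π ∣ MvPowerSeries.coeff e (defect f g φ) := by
  obtain ⟨p, r, hp, hqpr, -⟩ := hA.exists_prime
  have hq : q ≠ 0 := by rw [hqpr]; exact pow_ne_zero _ hp.ne_zero
  set mk := Ideal.Quotient.mk (Ideal.span {π}) with hmk
  rw [← Ideal.mem_span_singleton, ← Ideal.Quotient.eq_zero_iff_mem, ← hmk,
    ← MvPowerSeries.coeff_map, defect, map_sub, compLeft, compRight,
    PowerSeries.map_subst (hasSubst_of_constantCoeff hφ), hf.map_mk,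
    MvPowerSeries.map_subst (hasSubst_compRight hg.constantCoeff_eq_zero)]
  have hX : ∀ i : σ, (PowerSeries.subst (MvPowerSeries.X i : MvPowerSeries σ A) g).map mk =
      (MvPowerSeries.X i) ^ q := by
    intro i
    rw [PowerSeries.map_subst (PowerSeries.HasSubst.of_constantCoeff_zero
      (MvPowerSeries.constantCoeff_X i)), hg.map_mk, MvPowerSeries.map_X,
      PowerSeries.subst_pow (PowerSeries.HasSubst.of_constantCoeff_zero
        (MvPowerSeries.constantCoeff_X i)), PowerSeries.subst_X
        (PowerSeries.HasSubst.of_constantCoeff_zero (MvPowerSeries.constantCoeff_X i))]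
  have hφm : PowerSeries.HasSubst (φ.map mk) := by
    refine PowerSeries.HasSubst.of_constantCoeff_zero ?_
    rw [MvPowerSeries.constantCoeff_map, hφ, map_zero]
  simp_rw [hX]
  rw [PowerSeries.subst_pow hφm, PowerSeries.subst_X hφm, pow_eq_expand_of_isLTRing hA hq,
    MvPowerSeries.expand, MvPowerSeries.coe_substAlgHom, sub_self, map_zero]

end Frobenius


/-! ### Existence: successive approximation -/

section Existence

variable [Fintype σ]
variable {f g : PowerSeries A} {a : σ → A}

/-- An approximate solution to order `m + 2`: `φ ≡ Σ aᵢXᵢ (mod deg 2)`, `D φ ≡ 0 (mod deg m+2)`.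
[cite: CasselsFrohlichANT1967, Ch. VI §3.5 Prop. 5 (proof)] -/
structure Approx (f g : PowerSeries A) (a : σ → A) (m : ℕ) where
  /-- the approximant [folklore] -/
  φ : MvPowerSeries σ A
  constantCoeff_eq : φ.constantCoeff = 0
  coeff_single : ∀ i, MvPowerSeries.coeff (Finsupp.single i 1) φ = a i
  le_order : ((m + 2 : ℕ) : ℕ∞) ≤ (defect f g φ).order

/-- Stage `0`: the linear part. [folklore] -/
def Approx.zero (hf0 : PowerSeries.constantCoeff f = 0) (hf1 : PowerSeries.coeff 1 f = π)
    (hg0 : PowerSeries.constantCoeff g = 0) (hg1 : PowerSeries.coeff 1 g = π) (a : σ → A) :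
    Approx f g a 0 where
  φ := linearPart a
  constantCoeff_eq := constantCoeff_linearPart a
  coeff_single := coeff_linearPart_single a
  le_order := two_le_order_defect_linearPart hf0 hf1 hg0 hg1 a

variable (hA : IsLTRing π q) (hf : IsLTSeries π q f) (hg : IsLTSeries π q g)
include hA hf hg

/-- The correction term at stage `m`: homogeneous of degree `m + 2`, with
`(π - π^{m+2}) δ = -(D φ)_{m+2}`. [cite: CasselsFrohlichANT1967, Ch. VI §3.5 Prop. 5 (proof)] -/
def Approx.corr {m : ℕ} (P : Approx f g a m) : MvPowerSeries σ A := fun e =>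
  if e.degree = m + 2 then
    -(((hA.isUnit_one_sub_pow (m + 1) (Nat.succ_pos m)).unit⁻¹ : Aˣ) *
      Classical.choose (dvd_coeff_defect hA hf hg P.constantCoeff_eq e))
  else 0

/-- Coefficients of the correction term (unfolding). [folklore] -/
theorem Approx.coeff_corr {m : ℕ} (P : Approx f g a m) (e : σ →₀ ℕ) :
    MvPowerSeries.coeff e (P.corr hA hf hg) = if e.degree = m + 2 then
      -(((hA.isUnit_one_sub_pow (m + 1) (Nat.succ_pos m)).unit⁻¹ : Aˣ) *
        Classical.choose (dvd_coeff_defect hA hf hg P.constantCoeff_eq e)) else 0 :=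
  rfl

/-- The correction term is concentrated in degree `m + 2`. [folklore] -/
theorem Approx.coeff_corr_of_ne {m : ℕ} (P : Approx f g a m) {e : σ →₀ ℕ} (he : e.degree ≠ m + 2) :
    MvPowerSeries.coeff e (P.corr hA hf hg) = 0 := by
  rw [P.coeff_corr, if_neg he]

/-- The correction term has order `≥ m + 2`. [folklore] -/
theorem Approx.le_order_corr {m : ℕ} (P : Approx f g a m) :
    ((m + 2 : ℕ) : ℕ∞) ≤ (P.corr hA hf hg).order :=
  nat_le_order fun e he => P.coeff_corr_of_ne hA hf hg (by exact_mod_cast he.ne)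

/-- `(π - π^{m+2}) · δ = -(D φ)_{m+2}` coefficientwise. [folklore] -/
theorem Approx.coeff_C_mul_corr {m : ℕ} (P : Approx f g a m) (e : σ →₀ ℕ) :
    MvPowerSeries.coeff e (MvPowerSeries.C (π - π ^ (m + 2)) * P.corr hA hf hg) =
      if e.degree = m + 2 then -MvPowerSeries.coeff e (defect f g P.φ) else 0 := by
  rw [MvPowerSeries.coeff_C_mul, P.coeff_corr]
  split_ifs with he
  · have hc := Classical.choose_spec (dvd_coeff_defect hA hf hg P.constantCoeff_eq e)
    set c := Classical.choose (dvd_coeff_defect hA hf hg P.constantCoeff_eq e)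
    set u := (hA.isUnit_one_sub_pow (m + 1) (Nat.succ_pos m)).unit
    have hu : (1 - π ^ (m + 1)) * ((u⁻¹ : Aˣ) : A) = 1 := by
      rw [show (1 - π ^ (m + 1)) = ((u : Aˣ) : A) from rfl, Units.mul_inv]
    rw [hc]
    linear_combination (-(π * c)) * hu
  · rw [mul_zero]

/-- The next approximant `φ + δ`. [cite: CasselsFrohlichANT1967, Ch. VI §3.5 Prop. 5 (proof)] -/
def Approx.next {m : ℕ} (P : Approx f g a m) : Approx f g a (m + 1) where
  φ := P.φ + P.corr hA hf hg
  constantCoeff_eq := by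
    rw [map_add, P.constantCoeff_eq, zero_add, ← MvPowerSeries.coeff_zero_eq_constantCoeff_apply,
      P.coeff_corr_of_ne hA hf hg (by simp)]
  coeff_single i := by
    rw [map_add, P.coeff_single, P.coeff_corr_of_ne hA hf hg (by simp), add_zero]
  le_order := by
    have hkey := le_order_defect_sub (σ := σ) hf.coeff_one hg.constantCoeff_eq_zero hg.coeff_one
      (φ := P.φ) (φ' := P.φ + P.corr hA hf hg) P.constantCoeff_eq (by
        rw [map_add, P.constantCoeff_eq, zero_add,
          ← MvPowerSeries.coeff_zero_eq_constantCoeff_apply,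
          P.coeff_corr_of_ne hA hf hg (by simp)]) (m := m + 1)
      (by rw [add_sub_cancel_left]; exact P.le_order_corr hA hf hg)
    rw [add_sub_cancel_left] at hkey
    -- `D φ + (π - π^{m+2}) δ = D φ - (D φ)_{m+2}` has order `≥ m + 3`
    have h2 : ((m + 1 + 2 : ℕ) : ℕ∞) ≤
        (defect f g P.φ + MvPowerSeries.C (π - π ^ (m + 1 + 1)) * P.corr hA hf hg).order := by
      refine nat_le_order fun e he => ?_
      rw [map_add, show m + 1 + 1 = m + 2 by ring, P.coeff_C_mul_corr]
      split_ifs with hdeg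
      · rw [add_neg_cancel]
      · rw [add_zero]
        refine coeff_of_lt_order (lt_of_lt_of_le ?_ P.le_order)
        have : e.degree < m + 1 + 2 := by exact_mod_cast he
        exact_mod_cast (show e.degree < m + 2 by omega)
    have : defect f g (P.φ + P.corr hA hf hg) =
        (defect f g (P.φ + P.corr hA hf hg) - defect f g P.φ -
          MvPowerSeries.C (π - π ^ (m + 1 + 1)) * P.corr hA hf hg) +
        (defect f g P.φ + MvPowerSeries.C (π - π ^ (m + 1 + 1)) * P.corr hA hf hg) := by ring
    rw [this]
    exact le_trans (le_min hkey h2) min_order_le_add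

/-- Passing to the next approximant does not change coefficients of degree `≠ m + 2`.
[folklore] -/
theorem Approx.coeff_next {m : ℕ} (P : Approx f g a m) {e : σ →₀ ℕ} (he : e.degree ≠ m + 2) :
    MvPowerSeries.coeff e (P.next hA hf hg).φ = MvPowerSeries.coeff e P.φ := by
  rw [Approx.next, map_add, P.coeff_corr_of_ne hA hf hg he, add_zero]

/-- The sequence of approximants. [folklore] -/
def approxSeq (a : σ → A) : (m : ℕ) → Approx f g a m
  | 0 => Approx.zero hf.constantCoeff_eq_zero hf.coeff_one hg.constantCoeff_eq_zero hg.coeff_one a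
  | m + 1 => (approxSeq a m).next hA hf hg

/-- Stability of coefficients along the sequence. [folklore] -/
theorem coeff_approxSeq_of_le {m M : ℕ} (hmM : m ≤ M) {e : σ →₀ ℕ} (he : e.degree ≤ m + 1) :
    MvPowerSeries.coeff e (approxSeq hA hf hg a M).φ =
      MvPowerSeries.coeff e (approxSeq hA hf hg a m).φ := by
  induction M, hmM using Nat.le_induction with
  | base => rfl
  | succ M hmM ih =>
    rw [approxSeq, Approx.coeff_next hA hf hg _ (by omega), ih]

/-- The limit power series. [folklore] -/
def limit (a : σ → A) : MvPowerSeries σ A := fun e =>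
  MvPowerSeries.coeff e (approxSeq hA hf hg a e.degree).φ

/-- The coefficients of the limit of degree `≤ M + 1` are those of the `M`-th approximant.
[folklore] -/
theorem coeff_limit {M : ℕ} {e : σ →₀ ℕ} (he : e.degree ≤ M + 1) :
    MvPowerSeries.coeff e (limit hA hf hg a) =
      MvPowerSeries.coeff e (approxSeq hA hf hg a M).φ := by
  change MvPowerSeries.coeff e (approxSeq hA hf hg a e.degree).φ = _
  rcases Nat.lt_or_ge M e.degree with h | h
  · have : e.degree = M + 1 := by omega
    rw [this]
    exact coeff_approxSeq_of_le hA hf hg (Nat.le_succ M) (by omega)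
  · exact (coeff_approxSeq_of_le hA hf hg h (Nat.le_succ _)).symm

/-- The limit agrees with the `M`-th approximant to order `M + 2`. [folklore] -/
theorem le_order_limit_sub (M : ℕ) :
    ((M + 2 : ℕ) : ℕ∞) ≤ (limit hA hf hg a - (approxSeq hA hf hg a M).φ).order :=
  nat_le_order fun e he => by
    rw [map_sub, coeff_limit hA hf hg (M := M) (by exact_mod_cast Nat.lt_succ_iff.mp he), sub_self]

/-- The limit has no constant term. [folklore] -/
theorem constantCoeff_limit : (limit hA hf hg a).constantCoeff = 0 := by
  rw [← MvPowerSeries.coeff_zero_eq_constantCoeff_apply, coeff_limit hA hf hg (M := 0) (by simp),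
    MvPowerSeries.coeff_zero_eq_constantCoeff_apply]
  exact (approxSeq hA hf hg a 0).constantCoeff_eq

/-- The limit has the prescribed linear part. [folklore] -/
theorem coeff_limit_single (i : σ) :
    MvPowerSeries.coeff (Finsupp.single i 1) (limit hA hf hg a) = a i := by
  rw [coeff_limit hA hf hg (M := 0) (by simp)]
  exact (approxSeq hA hf hg a 0).coeff_single i

/-- **The limit solves `f ∘ φ = φ ∘ (g,…,g)`.** [cite: LubinTate1965, §1 Lemma 1] -/
theorem defect_limit : defect f g (limit hA hf hg a) = 0 := by
  have h : ∀ M : ℕ, ((M + 2 : ℕ) : ℕ∞) ≤ (defect f g (limit hA hf hg a)).order := by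
    intro M
    have hkey := le_order_defect_sub (σ := σ) hf.coeff_one hg.constantCoeff_eq_zero hg.coeff_one
      (approxSeq hA hf hg a M).constantCoeff_eq (constantCoeff_limit hA hf hg) (m := M + 1)
      (le_order_limit_sub hA hf hg M)
    have h1 := (approxSeq hA hf hg a M).le_order
    have h3 : ((M + 2 : ℕ) : ℕ∞) ≤ (MvPowerSeries.C (π - π ^ (M + 1 + 1)) *
        (limit hA hf hg a - (approxSeq hA hf hg a M).φ)).order :=
      le_trans (le_order_limit_sub hA hf hg M) (le_trans le_add_self le_order_mul)
    have : defect f g (limit hA hf hg a) =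
        (defect f g (limit hA hf hg a) - defect f g (approxSeq hA hf hg a M).φ -
          MvPowerSeries.C (π - π ^ (M + 1 + 1)) *
            (limit hA hf hg a - (approxSeq hA hf hg a M).φ)) +
        (defect f g (approxSeq hA hf hg a M).φ +
          MvPowerSeries.C (π - π ^ (M + 1 + 1)) *
            (limit hA hf hg a - (approxSeq hA hf hg a M).φ)) := by
      ring
    rw [this]
    refine le_trans (le_min (le_trans (by exact_mod_cast (by omega : M + 2 ≤ M + 1 + 2)) hkey)
      (le_trans (le_min h1 h3) min_order_le_add)) min_order_le_add
  ext e
  rw [MvPowerSeries.coeff_zero]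
  have hlt : ((e.degree : ℕ) : ℕ∞) < ((e.degree + 2 : ℕ) : ℕ∞) := by exact_mod_cast (by omega)
  exact coeff_of_lt_order (lt_of_lt_of_le hlt (h e.degree))

/-! ### Uniqueness -/

omit [Fintype σ] hA hf hg in
/-- A multi-index of degree one is `single i 1`. [folklore] -/
theorem exists_eq_single_of_degree_eq_one {e : σ →₀ ℕ} (he : e.degree = 1) :
    ∃ i, e = Finsupp.single i 1 := by
  have hne : e ≠ 0 := by
    rintro rfl
    simp at he
  obtain ⟨i, hi⟩ := Finsupp.ne_iff.mp hne
  refine ⟨i, ?_⟩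
  have hle : Finsupp.single i (e i) ≤ e := by
    intro j
    by_cases hij : j = i
    · subst hij; simp
    · simp [Ne.symm hij]
  obtain ⟨e', he'⟩ := exists_add_of_le hle
  have hdeg := congrArg Finsupp.degree he'
  rw [map_add, Finsupp.degree_single, he] at hdeg
  have hi1 : e i = 1 := by
    have : e i ≠ 0 := by simpa using hi
    omega
  have he'0 : e' = 0 := by
    rw [← Finsupp.degree_eq_zero_iff]
    omega
  rw [he', he'0, add_zero, hi1]

/-- **Uniqueness** in Lubin–Tate's lemma: two solutions with the same linear part coincide.
[cite: LubinTate1965, §1 Lemma 1] -/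
theorem eq_of_defect_eq_zero {φ ψ : MvPowerSeries σ A} (hφ0 : φ.constantCoeff = 0)
    (hψ0 : ψ.constantCoeff = 0)
    (hlin : ∀ i, MvPowerSeries.coeff (Finsupp.single i 1) φ =
      MvPowerSeries.coeff (Finsupp.single i 1) ψ)
    (hφ : defect f g φ = 0) (hψ : defect f g ψ = 0) : φ = ψ := by
  -- by induction, `ord (ψ - φ) ≥ m + 1` for all `m ≥ 1`
  have key : ∀ m : ℕ, ((m + 2 : ℕ) : ℕ∞) ≤ (ψ - φ).order := by
    intro m
    induction m with
    | zero =>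
      refine nat_le_order fun e he => ?_
      have he2 : e.degree < 2 := by exact_mod_cast he
      rw [map_sub, sub_eq_zero]
      interval_cases h : e.degree
      · rw [Finsupp.degree_eq_zero_iff] at h
        rw [h, MvPowerSeries.coeff_zero_eq_constantCoeff_apply,
          MvPowerSeries.coeff_zero_eq_constantCoeff_apply, hφ0, hψ0]
      · obtain ⟨i, rfl⟩ := exists_eq_single_of_degree_eq_one h
        exact (hlin i).symm
    | succ m ih =>
      have hkey := le_order_defect_sub (σ := σ) hf.coeff_one hg.constantCoeff_eq_zero hg.coeff_one
        hφ0 hψ0 (m := m + 1) ih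
      rw [hφ, hψ, sub_self, zero_sub, order_neg] at hkey
      refine nat_le_order fun e he => ?_
      have he' : e.degree < m + 1 + 2 := by exact_mod_cast he
      rcases Nat.lt_or_ge e.degree (m + 2) with hlt | hge
      · exact coeff_of_lt_order (lt_of_lt_of_le (by exact_mod_cast hlt) ih)
      · have hdeg : e.degree = m + 2 := by omega
        have h0 := coeff_of_lt_order (lt_of_lt_of_le (by exact_mod_cast he') hkey)
        rw [MvPowerSeries.coeff_C_mul, sub_mul] at h0
        -- `π c = π^{m+2} c` forces `c = 0`
        have h1 : π * ((1 - π ^ (m + 1)) * MvPowerSeries.coeff e (ψ - φ)) = 0 := by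
          rw [← h0]; ring
        have h2 := hA.eq_zero_of_mul_eq_zero _ h1
        have h3 := (hA.isUnit_one_sub_pow (m + 1) (Nat.succ_pos m)).mul_right_eq_zero.mp h2
        exact h3
  have hsub : ψ - φ = 0 := by
    ext e
    rw [MvPowerSeries.coeff_zero]
    have hlt : ((e.degree : ℕ) : ℕ∞) < ((e.degree + 2 : ℕ) : ℕ∞) := by exact_mod_cast (by omega)
    exact coeff_of_lt_order (lt_of_lt_of_le hlt (key e.degree))
  exact (sub_eq_zero.mp hsub).symm

/-! ### Lubin–Tate's lemma -/

/-- **Lubin–Tate's lemma** (Lubin–Tate 1965, Lemma 1; Cassels–Fröhlich VI §3.5 Prop. 5).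
[cite: LubinTate1965, §1 Lemma 1] -/
theorem exists_unique (a : σ → A) :
    ∃! φ : MvPowerSeries σ A, φ.constantCoeff = 0 ∧
      (∀ i, MvPowerSeries.coeff (Finsupp.single i 1) φ = a i) ∧
      PowerSeries.subst φ f =
        MvPowerSeries.subst (fun i : σ => PowerSeries.subst (MvPowerSeries.X i) g) φ := by
  refine ⟨limit hA hf hg a, ⟨constantCoeff_limit hA hf hg, coeff_limit_single hA hf hg,
    sub_eq_zero.mp (defect_limit hA hf hg)⟩, ?_⟩
  rintro ψ ⟨hψ0, hψ1, hψ⟩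
  refine (eq_of_defect_eq_zero hA hf hg (constantCoeff_limit hA hf hg) hψ0 (fun i => ?_)
    (defect_limit hA hf hg) (sub_eq_zero.mpr hψ)).symm
  rw [coeff_limit_single, hψ1]

end Existence


/-! ### Composition lemmas -/

section Composition

variable [Fintype σ] {τ : Type*} [Fintype τ]

/-- **Equivariance of composition.**  If `f ∘ F = F ∘ (g,…,g)` and `g ∘ bⱼ = bⱼ ∘ (h,…,h)` for all
`j` (all series without constant terms), then `H = F ∘ b` satisfies `f ∘ H = H ∘ (h,…,h)`.
[cite: CasselsFrohlichANT1967, Ch. VI §3.5 (proofs of Props. 1–3)] -/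
theorem compLeft_subst_eq_compRight {f g h : PowerSeries A} (hg0 : PowerSeries.constantCoeff g = 0)
    (hh0 : PowerSeries.constantCoeff h = 0) {F : MvPowerSeries σ A} (hF0 : F.constantCoeff = 0)
    (hF : compLeft f F = compRight g F) {b : σ → MvPowerSeries τ A}
    (hb0 : ∀ j, (b j).constantCoeff = 0) (hb : ∀ j, compLeft g (b j) = compRight h (b j)) :
    compLeft f (MvPowerSeries.subst b F) = compRight h (MvPowerSeries.subst b F) := by
  have hbs : MvPowerSeries.HasSubst b := MvPowerSeries.hasSubst_of_constantCoeff_zero hb0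
  have hFs : PowerSeries.HasSubst F := hasSubst_of_constantCoeff hF0
  have hgX : MvPowerSeries.HasSubst
      (fun i : σ => PowerSeries.subst (MvPowerSeries.X i : MvPowerSeries σ A) g) :=
    hasSubst_compRight hg0
  have hhX : MvPowerSeries.HasSubst
      (fun i : τ => PowerSeries.subst (MvPowerSeries.X i : MvPowerSeries τ A) h) :=
    hasSubst_compRight hh0
  simp only [compLeft, compRight] at hF hb ⊢
  have h1 : PowerSeries.subst (MvPowerSeries.subst b F) f =
      MvPowerSeries.subst b (PowerSeries.subst F f) := by
    rw [PowerSeries.subst_def, PowerSeries.subst_def,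
      MvPowerSeries.subst_comp_subst_apply hFs.const hbs]
  have h2 : ∀ i : σ, MvPowerSeries.subst b
      (PowerSeries.subst (MvPowerSeries.X i : MvPowerSeries σ A) g) =
        PowerSeries.subst (b i) g := by
    intro i
    rw [PowerSeries.subst_def, PowerSeries.subst_def, MvPowerSeries.subst_comp_subst_apply
      (PowerSeries.HasSubst.of_constantCoeff_zero (MvPowerSeries.constantCoeff_X i)).const hbs,
      MvPowerSeries.subst_X hbs]
  rw [h1, hF, MvPowerSeries.subst_comp_subst_apply hgX hbs,
    MvPowerSeries.subst_comp_subst_apply hbs hhX]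
  congr 1
  funext i
  rw [h2 i, hb i]

omit [Fintype σ] in
/-- A variable is equivariant: `g ∘ X_k = X_k ∘ (g,…,g)`. [folklore] -/
theorem compLeft_X {g : PowerSeries A} (hg0 : PowerSeries.constantCoeff g = 0) (k : τ) :
    compLeft g (MvPowerSeries.X k : MvPowerSeries τ A) = compRight g (MvPowerSeries.X k) := by
  rw [compLeft, compRight, MvPowerSeries.subst_X (hasSubst_compRight hg0)]

omit [Fintype τ] in
/-- Linear coefficients of a substitution (no constant terms). [folklore] -/
theorem coeff_single_subst {F : MvPowerSeries σ A} {b : σ → MvPowerSeries τ A}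
    (hb0 : ∀ j, (b j).constantCoeff = 0) (i : τ) :
    MvPowerSeries.coeff (Finsupp.single i 1) (MvPowerSeries.subst b F) =
      ∑ j, MvPowerSeries.coeff (Finsupp.single j 1) F *
        MvPowerSeries.coeff (Finsupp.single i 1) (b j) := by
  classical
  have hbs : MvPowerSeries.HasSubst b := MvPowerSeries.hasSubst_of_constantCoeff_zero hb0
  rw [MvPowerSeries.coeff_subst hbs]
  -- only the `d` of degree `1` contribute
  rw [finsum_eq_sum_of_support_subset _ (s := (Finset.univ : Finset σ).image
    fun j => Finsupp.single j 1)]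
  · rw [Finset.sum_image (fun j _ k _ h => Finsupp.single_left_injective one_ne_zero h)]
    refine Finset.sum_congr rfl fun j _ => ?_
    rw [smul_eq_mul, Finsupp.prod_single_index (by simp), pow_one]
  · intro d hd
    rw [Function.mem_support] at hd
    rw [Finset.coe_image, Set.mem_image]
    -- `deg d ≤ 1`, `d ≠ 0`
    have hprod0 : ∀ d : σ →₀ ℕ, (d.degree : ℕ∞) ≤
        (d.prod fun s e => b s ^ e).order := fun d => by
      rw [Finsupp.prod, Finsupp.degree_apply, Nat.cast_sum]
      refine le_trans (Finset.sum_le_sum fun s _ => ?_) (le_order_prod _ _)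
      exact le_order_pow_of_constantCoeff_eq_zero _ (hb0 s)
    have hdeg : d.degree ≤ 1 := by
      by_contra hlt
      push Not at hlt
      apply hd
      rw [coeff_of_lt_order (lt_of_lt_of_le (by
        rw [Finsupp.degree_single]; exact_mod_cast hlt) (hprod0 d)), smul_zero]
    have hd0 : d ≠ 0 := by
      rintro rfl
      apply hd
      simp [MvPowerSeries.coeff_one]
    have hdeg1 : d.degree = 1 := by
      have : d.degree ≠ 0 := fun h0 => hd0 ((Finsupp.degree_eq_zero_iff _).mp h0)
      omega
    obtain ⟨j, rfl⟩ := exists_eq_single_of_degree_eq_one hdeg1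
    exact ⟨j, Finset.mem_coe.mpr (Finset.mem_univ j), rfl⟩

end Composition

/-! ### The Lubin–Tate formal group law `F_f` -/

section FormalGroupLaw

open FormalGroup

variable (hA : IsLTRing π q) {f g h : PowerSeries A} (hf : IsLTSeries π q f)
  (hg : IsLTSeries π q g) (hh : IsLTSeries π q h)

/-- Characterisation of the limit: any solution is the limit (uniqueness, repackaged).
[cite: LubinTate1965, §1 Lemma 1] -/
theorem eq_limit [Fintype σ] {a : σ → A} {H : MvPowerSeries σ A}
    (h0 : H.constantCoeff = 0) (h1 : ∀ i, MvPowerSeries.coeff (Finsupp.single i 1) H = a i)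
    (h2 : compLeft f H = compRight g H) : H = limit hA hf hg a :=
  eq_of_defect_eq_zero hA hf hg h0 (constantCoeff_limit hA hf hg)
    (fun i => by rw [h1, coeff_limit_single]) (sub_eq_zero.mpr h2) (defect_limit hA hf hg)

/-- The limit solves `f ∘ φ = φ ∘ (g, …, g)`. [cite: LubinTate1965, §1 Lemma 1] -/
theorem compLeft_limit [Fintype σ] (a : σ → A) :
    compLeft f (limit hA hf hg a) = compRight g (limit hA hf hg a) :=
  sub_eq_zero.mp (defect_limit hA hf hg)

/-- The series `F_f(X₀, X₁)`: the unique `F ≡ X₀ + X₁ (mod deg 2)` with `f ∘ F = F ∘ (f × f)`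
(Lubin–Tate 1965, (4)). [cite: LubinTate1965, §1 (4)] -/
def ltF : MvPowerSeries (Fin 2) A := limit hA hf hf (fun _ => 1)

/-- `F_f` has no constant term. [cite: LubinTate1965, §1 (4)] -/
theorem constantCoeff_ltF : (ltF hA hf).constantCoeff = 0 := constantCoeff_limit hA hf hf

/-- `F_f ≡ X + Y (mod deg 2)`. [cite: LubinTate1965, §1 (4)] -/
theorem coeff_ltF_single (i : Fin 2) :
    MvPowerSeries.coeff (Finsupp.single i 1) (ltF hA hf) = 1 :=
  coeff_limit_single hA hf hf i

/-- `f ∘ F_f = F_f ∘ (f × f)`, i.e. `f ∈ End(F_f)`. [cite: LubinTate1965, §1 (4)] -/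
theorem compLeft_ltF : compLeft f (ltF hA hf) = compRight f (ltF hA hf) := compLeft_limit hA hf hf _

/-- `F(u, v)` for series `u, v` without constant term is `f`-equivariant when `u, v` are.
[folklore] -/
theorem compLeft_ltF_subst {τ : Type*} [Fintype τ] {u v : MvPowerSeries τ A}
    (hu0 : u.constantCoeff = 0) (hv0 : v.constantCoeff = 0)
    (hu : compLeft f u = compRight f u) (hv : compLeft f v = compRight f v) :
    compLeft f (MvPowerSeries.subst ![u, v] (ltF hA hf)) =
      compRight f (MvPowerSeries.subst ![u, v] (ltF hA hf)) :=
  compLeft_subst_eq_compRight hf.constantCoeff_eq_zero hf.constantCoeff_eq_zero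
    (constantCoeff_ltF hA hf) (compLeft_ltF hA hf)
    (fun j => by fin_cases j <;> simpa) (fun j => by fin_cases j <;> simpa)

/-- `F_f(u, v)` has no constant term if `u, v` have none. [folklore] -/
theorem constantCoeff_ltF_subst {τ : Type*} [Fintype τ] {u v : MvPowerSeries τ A}
    (hu0 : u.constantCoeff = 0) (hv0 : v.constantCoeff = 0) :
    (MvPowerSeries.subst ![u, v] (ltF hA hf)).constantCoeff = 0 :=
  MvPowerSeries.constantCoeff_subst_eq_zero
    (MvPowerSeries.hasSubst_of_constantCoeff_zero (fun j => by fin_cases j <;> simpa))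
    (fun j => by fin_cases j <;> simpa) (constantCoeff_ltF hA hf)

/-- The linear part of `F_f(u, v)` is the sum of those of `u` and `v`. [folklore] -/
theorem coeff_single_ltF_subst {τ : Type*} [Fintype τ] {u v : MvPowerSeries τ A}
    (hu0 : u.constantCoeff = 0) (hv0 : v.constantCoeff = 0) (i : τ) :
    MvPowerSeries.coeff (Finsupp.single i 1) (MvPowerSeries.subst ![u, v] (ltF hA hf)) =
      MvPowerSeries.coeff (Finsupp.single i 1) u + MvPowerSeries.coeff (Finsupp.single i 1) v := by
  rw [coeff_single_subst (fun j => by fin_cases j <;> simpa), Fin.sum_univ_two,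
    coeff_ltF_single, coeff_ltF_single, one_mul, one_mul]
  rfl

/-- **The Lubin–Tate formal group law `F_f`** (Lubin–Tate 1965, Thm. 1; Cassels–Fröhlich VI §3.5
Prop. 1): the unique `F_f ≡ X + Y (mod deg 2)` with `f ∘ F_f = F_f ∘ (f × f)` is a commutative
formal group law; associativity (Lubin–Tate's (7)) and commutativity ((6)) hold because both
sides of each identity solve the same Lubin–Tate problem.
[cite: LubinTate1965, §1 Thm. 1 (6)–(7)] -/
def formalGroup : FormalGroup A where
  toPowerSeries := ltF hA hf
  zero_constantCoeff := constantCoeff_ltF hA hf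
  lin_coeff_X := coeff_ltF_single hA hf 0
  lin_coeff_Y := coeff_ltF_single hA hf 1
  assoc := by
    -- both sides are `f`-equivariant with linear part `Y₀ + Y₁ + Y₂`
    have hX : ∀ k : Fin 3, (MvPowerSeries.X k : MvPowerSeries (Fin 3) A).constantCoeff = 0 :=
      fun k => MvPowerSeries.constantCoeff_X k
    have hXe : ∀ k : Fin 3, compLeft f (MvPowerSeries.X k : MvPowerSeries (Fin 3) A) =
        compRight f (MvPowerSeries.X k) := fun k => compLeft_X hf.constantCoeff_eq_zero k
    have hL0 := constantCoeff_ltF_subst hA hf (hX 0) (hX 1)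
    have hR0 := constantCoeff_ltF_subst hA hf (hX 1) (hX 2)
    have hL := compLeft_ltF_subst hA hf (hX 0) (hX 1) (hXe 0) (hXe 1)
    have hR := compLeft_ltF_subst hA hf (hX 1) (hX 2) (hXe 1) (hXe 2)
    rw [eq_limit hA hf hf (a := fun _ => (1 : A)) (constantCoeff_ltF_subst hA hf hL0 (hX 2))
        (fun i => ?_) (compLeft_ltF_subst hA hf hL0 (hX 2) hL (hXe 2)),
      eq_limit hA hf hf (a := fun _ => (1 : A)) (constantCoeff_ltF_subst hA hf (hX 0) hR0)
        (fun i => ?_) (compLeft_ltF_subst hA hf (hX 0) hR0 (hXe 0) hR)]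
    · rw [coeff_single_ltF_subst hA hf (hX 0) hR0, coeff_single_ltF_subst hA hf (hX 1) (hX 2)]
      fin_cases i <;> simp [MvPowerSeries.coeff_X, Finsupp.single_eq_single_iff]
    · rw [coeff_single_ltF_subst hA hf hL0 (hX 2), coeff_single_ltF_subst hA hf (hX 0) (hX 1)]
      fin_cases i <;> simp [MvPowerSeries.coeff_X, Finsupp.single_eq_single_iff]

/-- The underlying series of the Lubin–Tate formal group law (unfolding). [folklore] -/
theorem formalGroup_toPowerSeries : (formalGroup hA hf).toPowerSeries = ltF hA hf := rfl

/-- `F_f` is commutative (Lubin–Tate's identity (6)). [cite: LubinTate1965, §1 Thm. 1 (6)] -/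
instance formalGroup_isComm : (formalGroup hA hf).IsComm := by
  refine ⟨?_⟩
  have hX : ∀ k : Fin 2, (MvPowerSeries.X k : MvPowerSeries (Fin 2) A).constantCoeff = 0 :=
    fun k => MvPowerSeries.constantCoeff_X k
  have hXe : ∀ k : Fin 2, compLeft f (MvPowerSeries.X k : MvPowerSeries (Fin 2) A) =
      compRight f (MvPowerSeries.X k) := fun k => compLeft_X hf.constantCoeff_eq_zero k
  change ltF hA hf = MvPowerSeries.subst ![MvPowerSeries.X 1, MvPowerSeries.X 0] (ltF hA hf)
  conv_lhs => rw [ltF]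
  refine (eq_limit hA hf hf (constantCoeff_ltF_subst hA hf (hX 1) (hX 0)) (fun i => ?_)
    (compLeft_ltF_subst hA hf (hX 1) (hX 0) (hXe 1) (hXe 0))).symm
  rw [coeff_single_ltF_subst hA hf (hX 1) (hX 0)]
  fin_cases i <;> simp [MvPowerSeries.coeff_X, Finsupp.single_eq_single_iff]

end FormalGroupLaw

/-! ### The homomorphisms `[a]_{f,g}` -/

section Hom

variable (hA : IsLTRing π q) {f g h : PowerSeries A} (hf : IsLTSeries π q f)
  (hg : IsLTSeries π q g) (hh : IsLTSeries π q h)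

/-- `compRight g φ` for one variable is substitution of `g`. [folklore] -/
theorem compRight_unit (g : PowerSeries A) (φ : MvPowerSeries Unit A) :
    compRight g φ = PowerSeries.subst g φ := by
  rw [compRight, PowerSeries.subst_def g]
  congr 1
  funext i
  exact PowerSeries.X_subst g

/-- **The series `[a]_{f,g}`** (Cassels–Fröhlich VI §3.5, proof of Prop. 2; Lubin–Tate 1965, (5)):
the unique `[a]_{f,g} ≡ aX (mod deg 2)` with `f ∘ [a]_{f,g} = [a]_{f,g} ∘ g` (Lubin–Tate 1965, (5)).
[cite: LubinTate1965, §1 (5)] -/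
def hom (a : A) : PowerSeries A := limit (σ := Unit) hA hf hg (fun _ => a)

/-- `[a]_{f,g}` has no constant term. [cite: CasselsFrohlichANT1967, Ch. VI §3.5 Prop. 2] -/
theorem constantCoeff_hom (a : A) : PowerSeries.constantCoeff (hom hA hf hg a) = 0 :=
  constantCoeff_limit hA hf hg

/-- `[a]_{f,g}` has no constant term (multivariate spelling). [folklore] -/
theorem constantCoeff_hom' (a : A) : MvPowerSeries.constantCoeff (hom hA hf hg a) = 0 :=
  constantCoeff_limit hA hf hg

/-- `[a]_{f,g} ≡ aX (mod deg 2)`. [cite: CasselsFrohlichANT1967, Ch. VI §3.5 Prop. 2] -/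
theorem coeff_one_hom (a : A) : PowerSeries.coeff 1 (hom hA hf hg a) = a := by
  have h := coeff_limit_single hA hf hg (a := fun _ : Unit => a) ()
  exact h

/-- `[a]_{f,g} ≡ aX (mod deg 2)` (multivariate spelling). [folklore] -/
theorem coeff_single_hom (a : A) (i : Unit) :
    MvPowerSeries.coeff (Finsupp.single i 1) (hom hA hf hg a) = a :=
  coeff_limit_single hA hf hg (a := fun _ : Unit => a) i

/-- The defining equation `f ∘ [a] = [a] ∘ g`.
[cite: CasselsFrohlichANT1967, Ch. VI §3.5 Prop. 2] -/
theorem subst_hom (a : A) :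
    PowerSeries.subst (hom hA hf hg a) f = PowerSeries.subst g (hom hA hf hg a) := by
  have h := compLeft_limit hA hf hg (σ := Unit) (fun _ => a)
  rwa [compRight_unit] at h

/-- `f ∘ [a]_{f,g} = [a]_{f,g} ∘ g` (defect spelling).
[cite: CasselsFrohlichANT1967, Ch. VI §3.5 Prop. 2] -/
theorem compLeft_hom (a : A) : compLeft f (hom hA hf hg a) = compRight g (hom hA hf hg a) :=
  compLeft_limit hA hf hg (σ := Unit) (fun _ => a)

/-- Uniqueness for `[a]_{f,g}`. [cite: CasselsFrohlichANT1967, Ch. VI §3.5 Prop. 2] -/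
theorem eq_hom {a : A} {H : PowerSeries A} (h0 : PowerSeries.constantCoeff H = 0)
    (h1 : PowerSeries.coeff 1 H = a)
    (h2 : PowerSeries.subst H f = PowerSeries.subst g H) : H = hom hA hf hg a := by
  refine eq_limit hA hf hg (σ := Unit) h0 (fun i => ?_) ?_
  · exact h1
  · rw [compRight_unit]; exact h2

/-- `[π]_f = f` (Lubin–Tate's identity (11); Cassels–Fröhlich VI §3.5, end of proof of Prop. 4).
[cite: LubinTate1965, §1 Thm. 1 (11)] -/
theorem hom_self_eq : hom hA hf hf π = f :=
  (eq_hom hA hf hf hf.constantCoeff_eq_zero hf.coeff_one rfl).symm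

/-- `[1]_f = X` (Lubin–Tate's identity (11)). [cite: LubinTate1965, §1 Thm. 1 (11)] -/
theorem hom_one : hom hA hf hf 1 = PowerSeries.X :=
  (eq_hom hA hf hf PowerSeries.constantCoeff_X (PowerSeries.coeff_one_X)
    (by rw [PowerSeries.X_subst, PowerSeries.subst_X
      (PowerSeries.HasSubst.of_constantCoeff_zero' hf.constantCoeff_eq_zero)])).symm

/-- **`[a]_{f,g} ∘ [b]_{g,h} = [ab]_{f,h}`** (Lubin–Tate's identity (9); Cassels–Fröhlich VI §3.5,
proof of Prop. 3). [cite: LubinTate1965, §1 Thm. 1 (9)] -/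
theorem hom_comp_hom (a b : A) :
    PowerSeries.subst (hom hA hg hh b) (hom hA hf hg a) = hom hA hf hh (a * b) := by
  have hb0 := constantCoeff_hom' hA hg hh b
  refine eq_limit hA hf hh (σ := Unit) (a := fun _ => a * b) ?_ (fun i => ?_) ?_
  · rw [PowerSeries.subst_def]
    exact MvPowerSeries.constantCoeff_subst_eq_zero
      (MvPowerSeries.hasSubst_of_constantCoeff_zero fun _ => hb0) (fun _ => hb0)
      (constantCoeff_hom' hA hf hg a)
  · rw [PowerSeries.subst_def, coeff_single_subst (fun _ => hb0), Fintype.sum_unique,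
      coeff_single_hom, coeff_single_hom]
  · rw [PowerSeries.subst_def]
    exact compLeft_subst_eq_compRight hg.constantCoeff_eq_zero hh.constantCoeff_eq_zero
      (constantCoeff_hom' hA hf hg a) (compLeft_hom hA hf hg a) (fun _ => hb0)
      (fun _ => compLeft_hom hA hg hh b)

/-- `[a]_{f,g}(X_k)` (the series in the variable `X_k`). [folklore] -/
def homX {τ : Type*} (a : A) (k : τ) : MvPowerSeries τ A :=
  PowerSeries.subst (MvPowerSeries.X k : MvPowerSeries τ A) (hom hA hf hg a)

/-- `[a]_{f,g}(X_k)` has no constant term. [folklore] -/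
theorem constantCoeff_homX {τ : Type*} [Fintype τ] (a : A) (k : τ) :
    (homX hA hf hg a k).constantCoeff = 0 := by
  rw [homX, PowerSeries.subst_def]
  exact MvPowerSeries.constantCoeff_subst_eq_zero
    (MvPowerSeries.hasSubst_of_constantCoeff_zero fun _ => MvPowerSeries.constantCoeff_X k)
    (fun _ => MvPowerSeries.constantCoeff_X k) (constantCoeff_hom' hA hf hg a)

/-- The linear part of `[a]_{f,g}(X_k)` is `a X_k`. [folklore] -/
theorem coeff_single_homX {τ : Type*} [Fintype τ] [DecidableEq τ] (a : A) (k i : τ) :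
    MvPowerSeries.coeff (Finsupp.single i 1) (homX hA hf hg a k) = if i = k then a else 0 := by
  rw [homX, PowerSeries.subst_def, coeff_single_subst (fun _ => MvPowerSeries.constantCoeff_X k),
    Fintype.sum_unique, MvPowerSeries.coeff_X, coeff_single_hom]
  by_cases hik : i = k
  · subst hik; simp
  · rw [if_neg (fun h => hik (Finsupp.single_left_injective one_ne_zero h)), if_neg hik, mul_zero]

/-- `[a]_{f,g}(X_k)` is `(f,g)`-equivariant. [folklore] -/
theorem compLeft_homX {τ : Type*} [Fintype τ] (a : A) (k : τ) :
    compLeft f (homX hA hf hg a k) = compRight g (homX hA hf hg a k) := by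
  rw [homX, PowerSeries.subst_def]
  exact compLeft_subst_eq_compRight hg.constantCoeff_eq_zero hg.constantCoeff_eq_zero
    (constantCoeff_hom' hA hf hg a) (compLeft_hom hA hf hg a)
    (fun _ => MvPowerSeries.constantCoeff_X k)
    (fun _ => compLeft_X hg.constantCoeff_eq_zero k)

/-- **`[a]_{f,g}` is a homomorphism `F_g → F_f`**: `F_f([a](X), [a](Y)) = [a](F_g(X, Y))`
(Lubin–Tate's identity (8), their "sample" case; Cassels–Fröhlich VI §3.5, proof of Prop. 2): both
sides solve the Lubin–Tate problem for `(f, g)` with linear part `aX + aY`.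
[cite: LubinTate1965, §1 Thm. 1 (8)] -/
theorem ltF_subst_homX (a : A) :
    MvPowerSeries.subst ![homX hA hf hg a (0 : Fin 2), homX hA hf hg a 1] (ltF hA hf) =
      PowerSeries.subst (ltF hA hg) (hom hA hf hg a) := by
  have h0 := constantCoeff_homX hA hf hg a (0 : Fin 2)
  have h1 := constantCoeff_homX hA hf hg a (1 : Fin 2)
  have hL : MvPowerSeries.subst ![homX hA hf hg a (0 : Fin 2), homX hA hf hg a 1] (ltF hA hf) =
      limit hA hf hg (fun _ => a) := by
    refine eq_limit hA hf hg (constantCoeff_ltF_subst hA hf h0 h1) (fun i => ?_) ?_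
    · rw [coeff_single_ltF_subst hA hf h0 h1, coeff_single_homX, coeff_single_homX]
      fin_cases i <;> simp
    · have hb0 : ∀ j : Fin 2, ((![homX hA hf hg a (0 : Fin 2), homX hA hf hg a 1]) j).constantCoeff
          = 0 := fun j => by fin_cases j; exacts [h0, h1]
      have hb : ∀ j : Fin 2, compLeft f ((![homX hA hf hg a (0 : Fin 2), homX hA hf hg a 1]) j) =
          compRight g ((![homX hA hf hg a (0 : Fin 2), homX hA hf hg a 1]) j) := fun j => by
        fin_cases j; exacts [compLeft_homX hA hf hg a 0, compLeft_homX hA hf hg a 1]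
      exact compLeft_subst_eq_compRight hf.constantCoeff_eq_zero hg.constantCoeff_eq_zero
        (constantCoeff_ltF hA hf) (compLeft_ltF hA hf) hb0 hb
  have hR : PowerSeries.subst (ltF hA hg) (hom hA hf hg a) = limit hA hf hg (fun _ => a) := by
    rw [PowerSeries.subst_def]
    refine eq_limit hA hf hg ?_ (fun i => ?_) ?_
    · exact MvPowerSeries.constantCoeff_subst_eq_zero
        (MvPowerSeries.hasSubst_of_constantCoeff_zero fun _ => constantCoeff_ltF hA hg)
        (fun _ => constantCoeff_ltF hA hg) (constantCoeff_hom' hA hf hg a)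
    · rw [coeff_single_subst (fun _ => constantCoeff_ltF hA hg), Fintype.sum_unique,
        coeff_ltF_single, mul_one, coeff_single_hom]
    · exact compLeft_subst_eq_compRight hg.constantCoeff_eq_zero hg.constantCoeff_eq_zero
        (constantCoeff_hom' hA hf hg a) (compLeft_hom hA hf hg a)
        (fun _ => constantCoeff_ltF hA hg) (fun _ => compLeft_ltF hA hg)
  rw [hL, hR]

/-- **`[a + b]_{f,g} = F_f([a]_{f,g}, [b]_{f,g})`** (Lubin–Tate's identity (10); Cassels–Fröhlich VI
§3.5, proof of Prop. 3). [cite: LubinTate1965, §1 Thm. 1 (10)] -/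
theorem hom_add (a b : A) :
    hom hA hf hg (a + b) = MvPowerSeries.subst ![hom hA hf hg a, hom hA hf hg b] (ltF hA hf) := by
  have ha0 := constantCoeff_hom' hA hf hg a
  have hb0 := constantCoeff_hom' hA hf hg b
  symm
  refine eq_limit hA hf hg (σ := Unit) (a := fun _ => a + b)
    (constantCoeff_ltF_subst hA hf ha0 hb0) (fun i => ?_) ?_
  · rw [coeff_single_ltF_subst hA hf ha0 hb0, coeff_single_hom, coeff_single_hom]
  · have hc0 : ∀ j : Fin 2, ((![hom hA hf hg a, hom hA hf hg b] : Fin 2 → MvPowerSeries Unit A) j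
        ).constantCoeff = 0 := fun j => by fin_cases j; exacts [ha0, hb0]
    have hc : ∀ j : Fin 2, compLeft f ((![hom hA hf hg a, hom hA hf hg b] :
        Fin 2 → MvPowerSeries Unit A) j) = compRight g ((![hom hA hf hg a, hom hA hf hg b] :
        Fin 2 → MvPowerSeries Unit A) j) := fun j => by
      fin_cases j; exacts [compLeft_hom hA hf hg a, compLeft_hom hA hf hg b]
    exact compLeft_subst_eq_compRight hf.constantCoeff_eq_zero hg.constantCoeff_eq_zero
      (constantCoeff_ltF hA hf) (compLeft_ltF hA hf) hc0 hc

end Hom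

end LubinTate







end Literature.NumberTheory.GaloisRepresentations
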